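import Literature.IUT.HodgeTheaters.FactListL5GlobalFrobenioidsSchemas
import Literature.IUT.HodgeTheaters.ModSolReconstructionNonVacuity
import HarnessLib

/-!
# [IUTchI] Example 5.1 (i)/(v) predicates on the NF-bridge data — INSTANCE FORMS with the FACT-LIST
# declaration as conclusion head (rows F-2571 `MκIsInvariants`, F-2573 `FlStarPolyAction`,
# F-2579 `ModSolReconstruction.RecoversModel`)

S. Mochizuki, *Inter-universal Teichmüller theory I*, §5, Example 5.1 (i) pp. 123–125 and (v) p. 129
(kurims manuscript, May 2020) [claim: Mochizuki2012, status: disputed].  PROOF-ONLY companion (theorems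
only; no `def`, no `instance`) of abc-iut-L5-t1's `GlobalFrobenioids.lean` / `GlobalFrobenioidsInfKappa.lean`
and of the schema file `FactListL5GlobalFrobenioidsSchemas.lean`.

Bookkeeping context (abc-iut cell, block F, row INST59C of the LF kernel census `plan/LF-KERNEL-STATUS.tsv`):
the universal closures of the three rows are REFUTED in tree (`not_forall_mκIsInvariants`,
`not_forall_flStarPolyAction`, `ModSolReconstruction.not_forall_recoversModel`) and their satisfiable
instances are recorded only as `∃`-witnesses (`exists_mκIsInvariants`, `exists_flStarPolyAction`,
`ModSolReconstruction.exists_recoversModel`), which a conclusion-head census cannot see.  This file states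
the same instances with conclusion head LITERALLY the FACT-LIST declaration:

* F-2571 `mκIsInvariants_galoisModel_update` — at the Galois model `NFBridgeRecon.galoisModel F l`
  (GENUINE Galois/constant side `G_F ↷ F̄`, degenerate function-field side) UPDATED by print's own recipe
  `𝕄^⊛_κ := (𝕄^⊛_∞κ)^{π₁^rat}`, the predicate `MκIsInvariants` HOLDS (closed instance; the un-updated model
  is exactly where the closure refuter bites, `not_mκIsInvariants_galoisModel`);
* F-2573 `flStarPolyAction_galoisModel_update` — at the Galois model UPDATED by the tautological
  `𝔽_l^⋇` poly-action `Aut(†𝒟^⊚) := 𝔽_l^×`, `Aut_ε := {±1}`, `Aut^SL := Aut`, `Aut^SL_ε := {±1}`, the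
  predicate `FlStarPolyAction` HOLDS (closed instance; the refuter bites at `Aut := PUnit`, `l = 5`);
* F-2579 `ModSolReconstruction.RecoversModel.of_iso` — CONDITIONAL INSTANCE with content: the comparison
  predicate `RecoversModel` is stable under isomorphisms of the input pair (print, p. 129: "a functorial
  algorithm"), i.e. if `A` recovers the model data at `P` and `P ≅ Q` then `A` recovers them at `Q`
  (transport along the algorithm's functoriality isomorphism `A.map e`); and
  `ModSolReconstruction.recoversModel_of_equiv` — the predicate transported along an equivariant,
  `Kmod`-compatible ring isomorphism of OUTPUTS.  (A closed instance needs the constant algorithm of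
  `ModSolReconstructionNonVacuity.lean`, which is built inside a proof with a `letI` action and is not a
  named term of the tree; it stays the `∃`-witness `exists_recoversModel`.)

HONEST LABELS: the updated Galois models are DEGENERATE on the function-field / Aut side — instances of
OUR typed interface, not the `π₁(†𝒟^⊚)` of a `𝒟`-ΘNF-Hodge theater; nothing of [IUTchI] is asserted or
denied; refuted-closure ≠ refuted-in-print; instantiated ≠ endorsed; nothing here bears on [IUTchIII]
Cor. 3.12; typed ≠ proved. [claim: Mochizuki2012, status: disputed]
-/

noncomputable section

namespace Literature.IUT.HodgeTheaters

namespace NFBridgeRecon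

variable (F : Type) [Field F] [NumberField F] (l : ℕ)

/-! ### F-2571 `MκIsInvariants` at the updated Galois model -/

/-- **F-2571, INSTANCE FORM** ([IUTchI] Ex 5.1 (i) p.124: "`𝕄^⊛_κ` … may be identified with the
`π₁^rat`-invariants of `𝕄^⊛_∞κ`"): the Galois model `galoisModel F l` with its field `𝕄^⊛_κ` UPDATED to
the `π₁^rat`-invariants of `𝕄^⊛_∞κ` satisfies `MκIsInvariants` — by `rfl`, this being print's definition
read as a recipe.  Closed instance (binders: the number field `F`, the label `l`); degenerate
function-field side. ([IUTchI] Ex 5.1 (i) p.124) [claim: Mochizuki2012, status: disputed] -/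
theorem mκIsInvariants_galoisModel_update :
    Literature.IUT.HodgeTheaters.NFBridgeRecon.MκIsInvariants
      { galoisModel F l with
        Mκ := {f | f ∈ (galoisModel F l).Minfκ ∧ ∀ g : (galoisModel F l).piRat, g • f = f}
        mκ_subset := fun _ hf => hf.1 } :=
  ⟨rfl⟩

/-! ### F-2573 `FlStarPolyAction` at the updated Galois model -/

/-- **F-2573, INSTANCE FORM** ([IUTchI] Ex 5.1 (i) p.124: `Aut^SL/Aut^SL_ε ⥲ Aut/Aut_ε ⥲ 𝔽_l^⋇`): the
Galois model `galoisModel F l` with its Aut-data UPDATED to the tautological `𝔽_l^⋇` poly-action —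
`Aut(†𝒟^⊚) := 𝔽_l^×`, `Aut_ε := {±1}`, `Aut^SL := 𝔽_l^×` (as `⊤`), `Aut^SL_ε := {±1}`, all liftings the
identity — satisfies `FlStarPolyAction`: both subgroups are normal (`𝔽_l^×` is commutative),
`⊤ ⊓ {±1} = {±1}`, `⊤ ⊔ {±1} = ⊤`, and `Aut/Aut_ε = 𝔽_l^×/{±1}` IS `𝔽_l^⋇` (`MulEquiv.refl`).  Closed
instance; degenerate Aut-data. ([IUTchI] Ex 5.1 (i) p.124) [claim: Mochizuki2012, status: disputed] -/
theorem flStarPolyAction_galoisModel_update :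
    Literature.IUT.HodgeTheaters.NFBridgeRecon.FlStarPolyAction
      { galoisModel F l with
        AutD := (ZMod l)ˣ
        autGroup := inferInstance
        Autε := unitsPlusMinus l
        AutSL := ⊤
        AutSLε := unitsPlusMinus l
        autSLε_le := le_top
        autSLε_le_autε := le_rfl
        lift := fun _ => ContinuousMulEquiv.refl _ } :=
  { autε_normal := inferInstance
    autSLε_normal := inferInstance
    inf_eq := top_inf_eq _
    sup_eq := top_sup_eq _
    quotient_equiv := ⟨MulEquiv.refl _⟩ }

end NFBridgeRecon

/-! ### F-2579 `ModSolReconstruction.RecoversModel`: transport (conditional instance forms) -/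

namespace ModSolReconstruction

universe u

variable {N : NFBridgeRecon.{u}} (A : ModSolReconstruction N.piRat)

/-- The functoriality isomorphism of a reconstruction algorithm commutes with the `π₁^rat`-action also
in the inverse direction. ([IUTchI] Ex 5.1 (v) p.129) [claim: Mochizuki2012, status: disputed] -/
theorem map_symm_smul {P Q : CoricPair N.piRat} (e : CoricPair.Iso P Q) (g : N.piRat) (y : A.K Q) :
    (A.map e).symm (g • y) = g • (A.map e).symm y := by
  apply (A.map e).injective
  rw [RingEquiv.apply_symm_apply, A.map_smul, RingEquiv.apply_symm_apply]

/-- **F-2579, CONDITIONAL INSTANCE (transport along outputs)**: if the output of `A` at `Q` is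
`π₁^rat`-equivariantly ring-isomorphic to its output at `P`, compatibly with the sub-fields `Kmod`, and
`A` recovers the model data `𝕄̄^⊛_sol ∪ {0} ⊇ 𝕄̄^⊛_mod ∪ {0}` at `P`, then it recovers them at `Q`.
([IUTchI] Ex 5.1 (v) p.129) [claim: Mochizuki2012, status: disputed] -/
theorem recoversModel_of_equiv {P Q : CoricPair N.piRat} (ψ : A.K Q ≃+* A.K P)
    (hψ_smul : ∀ (g : N.piRat) (y : A.K Q), ψ (g • y) = g • ψ y)
    (hψ_mem : ∀ y : A.K Q, y ∈ A.Kmod Q ↔ ψ y ∈ A.Kmod P)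
    (h : Literature.IUT.HodgeTheaters.ModSolReconstruction.RecoversModel N A P) :
    Literature.IUT.HodgeTheaters.ModSolReconstruction.RecoversModel N A Q := by
  obtain ⟨φ, hφ_smul, hφ_mem⟩ := h.recovers
  refine ⟨ψ.trans φ, fun g y => ?_, fun y => ?_⟩
  · rw [RingEquiv.trans_apply, hψ_smul, hφ_smul, RingEquiv.trans_apply]
  · rw [hψ_mem, hφ_mem, RingEquiv.trans_apply]

/-- **F-2579, CONDITIONAL INSTANCE (functoriality in the input pair)** — print, p. 129: "a functorial
algorithm for reconstructing … `†𝕄^⊛_mod, †𝕄^⊛_sol`, together with the field structure": the typed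
comparison predicate `RecoversModel` is STABLE UNDER ISOMORPHISMS of the input `∞κ`-coric pair —
if `A` recovers the model data at `P` and `e : P ≅ Q`, then `A` recovers them at `Q` (transport along
`A.map e`).  ([IUTchI] Ex 5.1 (v) p.129) [claim: Mochizuki2012, status: disputed] -/
theorem RecoversModel.of_iso {P Q : CoricPair N.piRat} (e : CoricPair.Iso P Q)
    (h : Literature.IUT.HodgeTheaters.ModSolReconstruction.RecoversModel N A P) :
    Literature.IUT.HodgeTheaters.ModSolReconstruction.RecoversModel N A Q :=
  A.recoversModel_of_equiv (A.map e).symm (A.map_symm_smul e) (fun y => by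
    conv_lhs => rw [← (A.map e).apply_symm_apply y]
    exact (A.map_mem e _).symm) h

/-- Model witness in conclusion-head form, CONDITIONAL on the witness: every input pair admits SOME
algorithm recovering the model data at it (`exists_recoversModel`, the constant algorithm returning the
comparison field itself); combined with `RecoversModel.of_iso`, that algorithm then recovers the model
data at every pair isomorphic to it. ([IUTchI] Ex 5.1 (v) p.129) [claim: Mochizuki2012, status: disputed] -/
theorem exists_recoversModel_of_iso (P Q : CoricPair N.piRat) (e : CoricPair.Iso P Q) :
    ∃ A : ModSolReconstruction N.piRat,
      Literature.IUT.HodgeTheaters.ModSolReconstruction.RecoversModel N A P ∧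
        Literature.IUT.HodgeTheaters.ModSolReconstruction.RecoversModel N A Q := by
  obtain ⟨A, hA⟩ := exists_recoversModel N P
  exact ⟨A, hA, RecoversModel.of_iso A e hA⟩

end ModSolReconstruction

end Literature.IUT.HodgeTheaters

end
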